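import Mathlib
import Summits.Parity.BatemanHorn.Theorems.AlmostPrimeZerosSystemMertensCounting
import Literature.NumberTheory.Sieve.PolynomialCongruencesMeanValues
import Literature.NumberTheory.Sieve.ParityWave0SchinzelBatemanHornProofs
import HarnessLib

/-!
# Crux `SystemMomentDeficit` (stmt-Parity-11326), line `Ideator3Sketch`: `stub_nearPairCov`

Stub S3a (CRT-near pair block, termwise) of the line skeleton
`Summit.Parity.BatemanHorn.Cruxes.SystemMomentDeficit.Ideator3Sketch` for the crux
`Summit.Parity.BatemanHorn.Theses.AlmostPrimeZeros.SystemMomentDeficit`.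

Notation.  `Y = x + 1`, `m_i(n) = (g_i(n))⁺ = (g_i.eval n).toNat`, `ρ_i(q) = polyRootCountMod ![g_i] q`,
`E_i = #{n < Y : q_i ∣ m_i(n) ≠ 0}`, `E₁₂ = #{n < Y : q₁ ∣ m₁(n) ≠ 0 ∧ q₂ ∣ m₂(n) ≠ 0}`.

Statement.  Assume the CRT pair count (stub S1 of the skeleton, taken here as a HYPOTHESIS): for
coprime `q₁, q₂ ≥ 1`, `#{n < N : q₁ ∣ g₁(n), q₂ ∣ g₂(n)}` lies between `ρ₁(q₁)ρ₂(q₂)⌊N/(q₁q₂)⌋` and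
`ρ₁(q₁)ρ₂(q₂)(⌊N/(q₁q₂)⌋ + 1)`.  Then for `g₁, g₂ ∈ ℤ[X]` irreducible of positive degree with
positive leading coefficients there is `C` with
`(E₁/Y)(E₂/Y) − E₁₂/Y ≤ C/Y` for every `x` and every pair of COPRIME prime powers `q₁, q₂`.

Proof.
1. Marginal upper counts: `E_i ≤ #{n < Y : (q_i : ℤ) ∣ g_i(n)} ≤ ρ_i(q_i)(⌊Y/q_i⌋ + 1)`
   (`SystemMertens.card_filter_range_dvd_eval_le` of the counting file
   `AlmostPrimeZerosSystemMertensCounting.lean`).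
2. Joint lower count: `#{n < Y : q₁ ∣ g₁(n), q₂ ∣ g₂(n)} ≥ ρ₁ρ₂⌊Y/(q₁q₂)⌋` (the hypothesis), and the
   `ℤ`-divisibility set exceeds the `toNat` set by at most `n₀` elements, `n₀` such that
   `g₁(n), g₂(n) > 0` for `n ≥ n₀` (`Literature.NumberTheory.Sieve.eventually_eval_natCast_pos`,
   `SystemMertens.dvd_toNat_and_ne_zero_iff`).
3. Algebra: with `P = ρ₁ρ₂`, `E₁E₂ ≤ P(Y/q₁ + 1)(Y/q₂ + 1) = P·Y·(Y/(q₁q₂)) + P(Y/q₁ + Y/q₂ + 1)`,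
   `P·Y/(q₁q₂) ≤ E₁₂ + n₀ + P`, so `E₁E₂ − Y·E₁₂ ≤ (4P + n₀)Y`.
4. Uniform root bounds at prime powers: `ρ_i(p^a) ≤ (deg g_i)·M_i`
   (`Literature.NumberTheory.Sieve.exists_rootCount_primePow_le`, Hooley's Lemma 4), so
   `C = 4(d₁M₁)(d₂M₂) + n₀` works, uniformly in `x, q₁, q₂`.
Everything is [folklore]; no definitions are introduced.  (Only the counting file
`AlmostPrimeZerosSystemMertensCounting.lean` is imported on the Summits side, so that this file does
not depend on the route's Theses file.)
-/

namespace Summit.Parity.BatemanHorn.Cruxes.SystemMomentDeficit.Ideator3Sketch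

open Finset Polynomial Filter
open Literature.NumberTheory.Sieve
open Summit.Parity.BatemanHorn.Theorems.AlmostPrimeZeros.SystemMertens

/-- `#{n < N : q ∣ g(n)⁺ ≠ 0} ≤ #{n < N : (q : ℤ) ∣ g(n)}` (same statement as
`SystemMertens.card_filter_dvd_toNat_le` of `AlmostPrimeZerosSystemMertens.lean`, re-proved here to
keep the imports on the counting file). [folklore] -/
private theorem card_filter_dvd_toNat_le_int (g : ℤ[X]) (q N : ℕ) :
    #((range N).filter fun n : ℕ => q ∣ (g.eval (n : ℤ)).toNat ∧ (g.eval (n : ℤ)).toNat ≠ 0) ≤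
      #((range N).filter fun n : ℕ => (q : ℤ) ∣ g.eval (n : ℤ)) :=
  card_le_card fun n hn => by
    rw [mem_filter] at hn ⊢
    exact ⟨hn.1, (dvd_toNat_and_ne_zero_iff.1 hn.2).2⟩

/-- Natural division cast to `ℝ` from below: `a/b − 1 ≤ ⌊a/b⌋` for `b ≥ 1` (same statement as
`SystemMertens.div_sub_one_le_cast_div`). [folklore] -/
private theorem cast_div_sub_one_le (a : ℕ) {b : ℕ} (hb : 0 < b) :
    (a : ℝ) / b - 1 ≤ ((a / b : ℕ) : ℝ) := by
  have h : a < a / b * b + b := Nat.lt_div_mul_add hb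
  have hb' : (0 : ℝ) < b := by exact_mod_cast hb
  have h' : (a : ℝ) < ((a / b : ℕ) : ℝ) * b + b := by exact_mod_cast h
  rw [div_sub_one hb'.ne', div_le_iff₀ hb']
  linarith

/-- The real-algebra step: if `a ≤ ρ₁(Y/q₁ + 1)`, `b ≤ ρ₂(Y/q₂ + 1)`,
`ρ₁ρ₂(Y/(q₁q₂) − 1) ≤ c + n₀` with `Y, q₁, q₂ ≥ 1`, `b, ρ₁, ρ₂ ≥ 0`, `ρ₁ρ₂ ≤ R`, then
`(a/Y)(b/Y) − c/Y ≤ (4R + n₀)/Y`. [folklore] -/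
private theorem nearPairCov_algebra {a b c ρ₁ ρ₂ R n₀ Y q₁ q₂ : ℝ} (hY : 1 ≤ Y) (hq₁ : 1 ≤ q₁)
    (hq₂ : 1 ≤ q₂) (hb0 : 0 ≤ b) (hρ₁ : 0 ≤ ρ₁) (hρ₂ : 0 ≤ ρ₂) (hR : ρ₁ * ρ₂ ≤ R)
    (ha : a ≤ ρ₁ * (Y / q₁ + 1)) (hb : b ≤ ρ₂ * (Y / q₂ + 1))
    (hc : ρ₁ * ρ₂ * (Y / (q₁ * q₂) - 1) ≤ c + n₀) :
    a / Y * (b / Y) - c / Y ≤ (4 * R + n₀) / Y := by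
  have hY0 : 0 < Y := by linarith
  have hq₁0 : 0 < q₁ := by linarith
  have hq₂0 : 0 < q₂ := by linarith
  set u : ℝ := Y / q₁ with hu
  set v : ℝ := Y / q₂ with hv
  set w : ℝ := Y / (q₁ * q₂) with hw
  have hu1 : u ≤ Y := div_le_self hY0.le hq₁
  have hv1 : v ≤ Y := div_le_self hY0.le hq₂
  have hu0 : 0 ≤ u := div_nonneg hY0.le hq₁0.le
  have hv0 : 0 ≤ v := div_nonneg hY0.le hq₂0.le
  have huv : u * v = Y * w := by
    rw [hu, hv, hw, div_mul_div_comm, mul_div_assoc]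
  have hP0 : 0 ≤ ρ₁ * ρ₂ := mul_nonneg hρ₁ hρ₂
  have hab : a * b ≤ ρ₁ * ρ₂ * (Y * w) + ρ₁ * ρ₂ * (u + v + 1) := by
    calc a * b ≤ (ρ₁ * (u + 1)) * (ρ₂ * (v + 1)) :=
          mul_le_mul ha hb hb0 (mul_nonneg hρ₁ (by linarith))
      _ = ρ₁ * ρ₂ * (u * v) + ρ₁ * ρ₂ * (u + v + 1) := by ring
      _ = _ := by rw [huv]
  have h2 : ρ₁ * ρ₂ * (Y * w) ≤ Y * (c + n₀ + ρ₁ * ρ₂) := by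
    have hc' : ρ₁ * ρ₂ * w ≤ c + n₀ + ρ₁ * ρ₂ := by linarith
    have := mul_le_mul_of_nonneg_left hc' hY0.le
    linarith
  have h3 : ρ₁ * ρ₂ * (u + v + 1) ≤ ρ₁ * ρ₂ * (3 * Y) :=
    mul_le_mul_of_nonneg_left (by linarith) hP0
  have h4 : ρ₁ * ρ₂ * Y ≤ R * Y := mul_le_mul_of_nonneg_right hR hY0.le
  have hkey : a * b / Y - c ≤ 4 * R + n₀ := by
    rw [sub_le_iff_le_add, div_le_iff₀ hY0]
    linarith
  calc a / Y * (b / Y) - c / Y = (a * b / Y - c) / Y := by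
        field_simp
    _ ≤ (4 * R + n₀) / Y := div_le_div_of_nonneg_right hkey hY0.le

/-- From natural-number counts to the real inequality: if `a ≤ ρ₁(⌊(x+1)/q₁⌋ + 1)`,
`b ≤ ρ₂(⌊(x+1)/q₂⌋ + 1)`, `ρ₁ρ₂⌊(x+1)/(q₁q₂)⌋ ≤ c + n₀`, `ρ_i ≤ R_i`, `q_i ≥ 1`, then
`(a/(x+1))(b/(x+1)) − c/(x+1) ≤ (4R₁R₂ + n₀)/(x+1)`. [folklore] -/
private theorem nearPairCov_counts {a b c ρ₁ ρ₂ R₁ R₂ n₀ x q₁ q₂ : ℕ} (hq₁ : 0 < q₁) (hq₂ : 0 < q₂)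
    (hρ₁ : ρ₁ ≤ R₁) (hρ₂ : ρ₂ ≤ R₂)
    (ha : a ≤ ρ₁ * ((x + 1) / q₁ + 1)) (hb : b ≤ ρ₂ * ((x + 1) / q₂ + 1))
    (hc : ρ₁ * ρ₂ * ((x + 1) / (q₁ * q₂)) ≤ c + n₀) :
    (a : ℝ) / ((x : ℝ) + 1) * ((b : ℝ) / ((x : ℝ) + 1)) - (c : ℝ) / ((x : ℝ) + 1) ≤
      (4 * ((R₁ : ℝ) * R₂) + n₀) / ((x : ℝ) + 1) := by
  have hYnat : ((x + 1 : ℕ) : ℝ) = (x : ℝ) + 1 := by push_cast; ring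
  have hY1 : (1 : ℝ) ≤ (x : ℝ) + 1 := by
    have := (Nat.cast_nonneg x : (0 : ℝ) ≤ x)
    linarith
  have hq₁R : (1 : ℝ) ≤ q₁ := by exact_mod_cast hq₁
  have hq₂R : (1 : ℝ) ≤ q₂ := by exact_mod_cast hq₂
  have haR : (a : ℝ) ≤ (ρ₁ : ℝ) * (((x : ℝ) + 1) / q₁ + 1) := by
    have h2 : (((x + 1) / q₁ : ℕ) : ℝ) ≤ ((x : ℝ) + 1) / q₁ := by
      rw [← hYnat]; exact Nat.cast_div_le
    calc (a : ℝ) ≤ (ρ₁ : ℝ) * ((((x + 1) / q₁ : ℕ) : ℝ) + 1) := by exact_mod_cast ha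
      _ ≤ (ρ₁ : ℝ) * (((x : ℝ) + 1) / q₁ + 1) := by gcongr
  have hbR : (b : ℝ) ≤ (ρ₂ : ℝ) * (((x : ℝ) + 1) / q₂ + 1) := by
    have h2 : (((x + 1) / q₂ : ℕ) : ℝ) ≤ ((x : ℝ) + 1) / q₂ := by
      rw [← hYnat]; exact Nat.cast_div_le
    calc (b : ℝ) ≤ (ρ₂ : ℝ) * ((((x + 1) / q₂ : ℕ) : ℝ) + 1) := by exact_mod_cast hb
      _ ≤ (ρ₂ : ℝ) * (((x : ℝ) + 1) / q₂ + 1) := by gcongr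
  have hcR : (ρ₁ : ℝ) * ρ₂ * (((x : ℝ) + 1) / (q₁ * q₂) - 1) ≤ c + n₀ := by
    have h2 : ((x : ℝ) + 1) / (q₁ * q₂) - 1 ≤ (((x + 1) / (q₁ * q₂) : ℕ) : ℝ) := by
      have := cast_div_sub_one_le (x + 1) (Nat.mul_pos hq₁ hq₂)
      rw [hYnat] at this
      push_cast at this
      exact this
    have hP0 : (0 : ℝ) ≤ (ρ₁ : ℝ) * ρ₂ := by positivity
    calc (ρ₁ : ℝ) * ρ₂ * (((x : ℝ) + 1) / (q₁ * q₂) - 1)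
        ≤ (ρ₁ : ℝ) * ρ₂ * (((x + 1) / (q₁ * q₂) : ℕ) : ℝ) := mul_le_mul_of_nonneg_left h2 hP0
      _ ≤ c + n₀ := by exact_mod_cast hc
  have hR : (ρ₁ : ℝ) * ρ₂ ≤ (R₁ : ℝ) * R₂ := by exact_mod_cast Nat.mul_le_mul hρ₁ hρ₂
  exact nearPairCov_algebra hY1 hq₁R hq₂R (Nat.cast_nonneg b)
    (Nat.cast_nonneg ρ₁) (Nat.cast_nonneg ρ₂) hR haR hbR hcR

/-- The joint lower count, `toNat` version: if `g₁(n), g₂(n) > 0` for `n ≥ n₀`, then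
`#{n < N : q₁ ∣ g₁(n), q₂ ∣ g₂(n)} ≤ #{n < N : q₁ ∣ g₁(n)⁺ ≠ 0, q₂ ∣ g₂(n)⁺ ≠ 0} + n₀`
(the two sets agree on `n ≥ n₀`, `SystemMertens.dvd_toNat_and_ne_zero_iff`). [folklore] -/
private theorem card_filter_dvd_and_dvd_le_add (g₁ g₂ : ℤ[X]) (q₁ q₂ N : ℕ) {n₀ : ℕ}
    (hpos : ∀ n : ℕ, n₀ ≤ n → 0 < g₁.eval (n : ℤ) ∧ 0 < g₂.eval (n : ℤ)) :
    #((range N).filter fun n : ℕ => (q₁ : ℤ) ∣ g₁.eval (n : ℤ) ∧ (q₂ : ℤ) ∣ g₂.eval (n : ℤ)) ≤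
      #((range N).filter fun n : ℕ =>
        (q₁ ∣ (g₁.eval (n : ℤ)).toNat ∧ (g₁.eval (n : ℤ)).toNat ≠ 0) ∧
          (q₂ ∣ (g₂.eval (n : ℤ)).toNat ∧ (g₂.eval (n : ℤ)).toNat ≠ 0)) + n₀ := by
  calc #((range N).filter fun n : ℕ => (q₁ : ℤ) ∣ g₁.eval (n : ℤ) ∧ (q₂ : ℤ) ∣ g₂.eval (n : ℤ))
      ≤ #(((range N).filter fun n : ℕ =>
          (q₁ ∣ (g₁.eval (n : ℤ)).toNat ∧ (g₁.eval (n : ℤ)).toNat ≠ 0) ∧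
            (q₂ ∣ (g₂.eval (n : ℤ)).toNat ∧ (g₂.eval (n : ℤ)).toNat ≠ 0)) ∪ range n₀) := by
        refine card_le_card fun n hn => ?_
        rw [mem_filter] at hn
        rw [mem_union, mem_filter]
        by_cases h : n₀ ≤ n
        · exact Or.inl ⟨hn.1, dvd_toNat_and_ne_zero_iff.2 ⟨(hpos n h).1, hn.2.1⟩,
            dvd_toNat_and_ne_zero_iff.2 ⟨(hpos n h).2, hn.2.2⟩⟩
        · exact Or.inr (mem_range.2 (not_le.1 h))
    _ ≤ #((range N).filter fun n : ℕ =>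
          (q₁ ∣ (g₁.eval (n : ℤ)).toNat ∧ (g₁.eval (n : ℤ)).toNat ≠ 0) ∧
            (q₂ ∣ (g₂.eval (n : ℤ)).toNat ∧ (g₂.eval (n : ℤ)).toNat ≠ 0)) + #(range n₀) :=
        card_union_le _ _
    _ = _ := by rw [card_range]

/-- **Stub S3a (CRT-near pair block, termwise).** Assume the CRT pair count (stub S1): for
coprime `q₁, q₂ ≥ 1` the number of `n < N` with `q₁ ∣ g₁(n)`, `q₂ ∣ g₂(n)` lies between
`ρ₁(q₁)ρ₂(q₂)⌊N/(q₁q₂)⌋` and `ρ₁(q₁)ρ₂(q₂)(⌊N/(q₁q₂)⌋ + 1)`.  Then for two irreducible integer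
polynomials `g₁, g₂` of positive degree with positive leading coefficients there is `C` such that
for all `x` and all COPRIME prime powers `q₁, q₂`, with `Y = x + 1`, `m_i(n) = g_i(n)⁺`:
`(#{n < Y : q₁ ∣ m₁(n) ≠ 0}/Y)·(#{n < Y : q₂ ∣ m₂(n) ≠ 0}/Y) − #{n < Y : both}/Y ≤ C/Y`
— the product of the two marginal frequencies exceeds the joint frequency by at most `C/Y`
(CRT for the main terms, Hooley's uniform bound `ρ_i(p^a) ≤ d_i M_i` for the constants). [folklore] -/
theorem stub_nearPairCov :
    (∀ (g₁ g₂ : ℤ[X]) (q₁ q₂ N : ℕ), 0 < q₁ → 0 < q₂ → Nat.Coprime q₁ q₂ →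
      polyRootCountMod ![g₁] q₁ * polyRootCountMod ![g₂] q₂ * (N / (q₁ * q₂)) ≤
          #((Finset.range N).filter fun n : ℕ =>
            (q₁ : ℤ) ∣ g₁.eval (n : ℤ) ∧ (q₂ : ℤ) ∣ g₂.eval (n : ℤ)) ∧
        #((Finset.range N).filter fun n : ℕ =>
            (q₁ : ℤ) ∣ g₁.eval (n : ℤ) ∧ (q₂ : ℤ) ∣ g₂.eval (n : ℤ)) ≤
          polyRootCountMod ![g₁] q₁ * polyRootCountMod ![g₂] q₂ * (N / (q₁ * q₂) + 1)) →
    ∀ (g₁ g₂ : ℤ[X]), Irreducible g₁ → 0 < g₁.natDegree → 0 < g₁.leadingCoeff →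
      Irreducible g₂ → 0 < g₂.natDegree → 0 < g₂.leadingCoeff →
      ∃ C : ℝ, ∀ (x q₁ q₂ : ℕ), IsPrimePow q₁ → IsPrimePow q₂ → Nat.Coprime q₁ q₂ →
        (#((Finset.range (x + 1)).filter fun n : ℕ =>
              q₁ ∣ (g₁.eval (n : ℤ)).toNat ∧ (g₁.eval (n : ℤ)).toNat ≠ 0) : ℝ) / ((x : ℝ) + 1) *
            ((#((Finset.range (x + 1)).filter fun n : ℕ =>
              q₂ ∣ (g₂.eval (n : ℤ)).toNat ∧ (g₂.eval (n : ℤ)).toNat ≠ 0) : ℝ) / ((x : ℝ) + 1)) -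
          (#((Finset.range (x + 1)).filter fun n : ℕ =>
              (q₁ ∣ (g₁.eval (n : ℤ)).toNat ∧ (g₁.eval (n : ℤ)).toNat ≠ 0) ∧
                (q₂ ∣ (g₂.eval (n : ℤ)).toNat ∧ (g₂.eval (n : ℤ)).toNat ≠ 0)) : ℝ) / ((x : ℝ) + 1) ≤
          C / ((x : ℝ) + 1) := by
  intro hcrt g₁ g₂ hirr₁ hdeg₁ hlc₁ hirr₂ hdeg₂ hlc₂
  obtain ⟨M₁, -, hM₁, -⟩ := exists_rootCount_primePow_le hirr₁ hdeg₁
  obtain ⟨M₂, -, hM₂, -⟩ := exists_rootCount_primePow_le hirr₂ hdeg₂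
  obtain ⟨n₁, hn₁⟩ := eventually_atTop.1 (eventually_eval_natCast_pos hdeg₁ hlc₁)
  obtain ⟨n₂, hn₂⟩ := eventually_atTop.1 (eventually_eval_natCast_pos hdeg₂ hlc₂)
  have hpos : ∀ n : ℕ, n₁ + n₂ ≤ n → 0 < g₁.eval (n : ℤ) ∧ 0 < g₂.eval (n : ℤ) :=
    fun n hn => ⟨hn₁ n (by omega), hn₂ n (by omega)⟩
  refine ⟨4 * (((g₁.natDegree * M₁ : ℕ) : ℝ) * ((g₂.natDegree * M₂ : ℕ) : ℝ)) + ((n₁ + n₂ : ℕ) : ℝ),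
    fun x q₁ q₂ hq₁pp hq₂pp hcop => ?_⟩
  have hq₁ : 0 < q₁ := hq₁pp.pos
  have hq₂ : 0 < q₂ := hq₂pp.pos
  -- uniform root-count bounds at prime powers (Hooley)
  have hρ₁ : polyRootCountMod ![g₁] q₁ ≤ g₁.natDegree * M₁ := by
    obtain ⟨p, k, hp, -, hpk⟩ := (isPrimePow_nat_iff q₁).1 hq₁pp
    rw [← hpk]
    exact hM₁ p hp k
  have hρ₂ : polyRootCountMod ![g₂] q₂ ≤ g₂.natDegree * M₂ := by
    obtain ⟨p, k, hp, -, hpk⟩ := (isPrimePow_nat_iff q₂).1 hq₂pp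
    rw [← hpk]
    exact hM₂ p hp k
  -- marginal upper counts, joint lower count, then the real algebra
  exact nearPairCov_counts hq₁ hq₂ hρ₁ hρ₂
    ((card_filter_dvd_toNat_le_int g₁ q₁ (x + 1)).trans (card_filter_range_dvd_eval_le g₁ hq₁ (x + 1)))
    ((card_filter_dvd_toNat_le_int g₂ q₂ (x + 1)).trans (card_filter_range_dvd_eval_le g₂ hq₂ (x + 1)))
    ((hcrt g₁ g₂ q₁ q₂ (x + 1) hq₁ hq₂ hcop).1.trans
      (card_filter_dvd_and_dvd_le_add g₁ g₂ q₁ q₂ (x + 1) hpos))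

end Summit.Parity.BatemanHorn.Cruxes.SystemMomentDeficit.Ideator3Sketch
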